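import Mathlib.Analysis.Normed.Field.Basic
import Mathlib.Topology.Compactness.Compact
import HarnessLib

/-!
# Crux `FluctuationComparisonRegPrIntL` (stmt-QuantumFields-20520, rung R3), PATH-B organ O1, LINE g26-1 «mode_section», row MODE∘ `ModeSectionCan` —
# TOOLS for the knit «MODE∘ ⟸ UNIQ-MAX∘»: a Berge-type CONTINUITY THEOREM FOR UNIQUE FIBRE MAXIMISERS (local continuous sections in place of lower
# hemicontinuity; compact total space, Hausdorff base)

LEAD-20520 width seat ym-ust-20520-w3 g23 (cell ym3-torus), `--supports stmt-QuantumFields-20520` (helper).  THEOREMS ONLY, def-free, generic [folklore]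
topology over Mathlib (`tendsto_nhds_of_unique_mapClusterPt`: in a compact space a function converges along a filter to the unique cluster point).

★`continuousOn_of_unique_fibreMax`: `d : X → Y` (X compact, Y Hausdorff), `O ⊆ X` open with `d` and `g : X → ℝ` continuous on `O`, `K ⊆ O` closed;
(LIFT) every `U ∈ O` has a local continuous section of `d` through it (`Φ` continuous at `d U`, `Φ (d U) = U`, `d ∘ Φ = id` near `d U`); and on
`W ⊆ Y` a selection `Us` with `Us V ∈ K`, `d (Us V) = V`, `Us V` maximising `g` on the fibre piece `{U ∈ O | d U = V}` UNIQUELY.  Then `Us` is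
continuous on `W`.  Proof: a cluster point `x` of `Us` along `𝓝[W] V₀` lies in `K` (closed), over `V₀` (Hausdorff separation + continuity of
`d` at `x`), and dominates every competitor `U` over `V₀` (lift `U` to nearby fibres by (LIFT), compare with `Us` there, pass to the limit through
the continuity of `g` at `x` and at `U`) — so `x = Us V₀` by uniqueness, and compactness gives convergence.
(The MODE∘ use, ✓`…OrganTangentModeSectionKnit`: `d = descend F ℰp j` on the fine window, `g = ρ′_{j+1}`, `K` = the closed half-shell, (LIFT) = the
per-bond triangular chart of the (A)-road.)

HONEST FRAMING: elementary topology; nothing of Bałaban's is asserted or proved; UNIQ-MAX∘ (the analytic heart of MODE∘: one well, no orbit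
bifurcation), MODE∘ (as a row), TRM∘, LAP∘, LIN∘, O1, crux 20520, `YM3TorusSU2` are NOT proved; registry `Lines/semiclassical_s2beta.lean` v11.4 (★★OWNER
RULING №36) untouched; rung R3 = SU(2) YM₃ on T³ — NOT d = 4, NOT infinite volume, NOT a mass gap, NOT Clay; the Yang–Mills mass gap is NOT proved.
-/

set_option autoImplicit false

namespace Summit.QuantumFields.YangMills.Theorems.OrganTangentModeSectionTools

open Filter Topology Set Function

variable {X Y : Type*} [TopologicalSpace X] [TopologicalSpace Y]

/-- **CONTINUITY OF UNIQUE FIBRE MAXIMISERS (Berge-type, with local sections in place of lower hemicontinuity).**  Let `d : X → Y` map a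
compact space to a Hausdorff space, `O ⊆ X` open with `d` continuous on `O`, `g : X → ℝ` continuous on `O`, `K ⊆ O` closed, `W ⊆ Y`.  Suppose
(LIFT) every point `U ∈ O` has a local continuous section of `d` through it (`Φ` continuous at `d U`, `Φ (d U) = U`, `d (Φ V′) = V′` near `d U`),
and (UNIQ-MAX) for every `V ∈ W` the restriction of `g` to the fibre piece `{U ∈ O | d U = V}` attains its maximum at a UNIQUE point `Us V`, which
lies in `K`.  Then `Us` is continuous on `W`. [folklore] -/
theorem continuousOn_of_unique_fibreMax [CompactSpace X] [T2Space Y]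
    {d : X → Y} {O : Set X} (hO : IsOpen O) (hd : ContinuousOn d O) {g : X → ℝ} (hg : ContinuousOn g O)
    {K : Set X} (hK : IsClosed K) (hKO : K ⊆ O) {W : Set Y}
    (hlift : ∀ U ∈ O, ∃ Φ : Y → X, ContinuousAt Φ (d U) ∧ Φ (d U) = U ∧ ∀ᶠ V' in 𝓝 (d U), d (Φ V') = V')
    (Us : Y → X) (hUsK : ∀ V ∈ W, Us V ∈ K) (hUsd : ∀ V ∈ W, d (Us V) = V)
    (hmax : ∀ V ∈ W, ∀ U, d U = V → U ∈ O → g U ≤ g (Us V))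
    (huniq : ∀ V ∈ W, ∀ U, d U = V → U ∈ O → g (Us V) ≤ g U → U = Us V) :
    ContinuousOn Us W := by
  intro V₀ hV₀
  -- cluster points of `Us` along `𝓝[W] V₀` are all equal to `Us V₀`
  refine tendsto_nhds_of_unique_mapClusterPt fun x hx => ?_
  have hl : ∀ᶠ V in 𝓝[W] V₀, V ∈ W := self_mem_nhdsWithin
  -- (a) x ∈ K (K closed, Us ∈ K along the filter)
  have hxK : x ∈ K := by
    by_contra hxK
    have hfr := (mapClusterPt_iff_frequently.mp hx) Kᶜ (hK.isOpen_compl.mem_nhds hxK)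
    exact (hfr.and_eventually hl).exists.elim fun V hV => hV.1 (hUsK V hV.2)
  have hxO : x ∈ O := hKO hxK
  -- (b) d x = V₀ (Y Hausdorff; d ∘ Us = id along the filter)
  have hdx : d x = V₀ := by
    by_contra hne
    obtain ⟨A, B, hA, hB, hxA, hVB, hAB⟩ := t2_separation hne
    have h1 : ∃ᶠ V in 𝓝[W] V₀, Us V ∈ d ⁻¹' A :=
      (mapClusterPt_iff_frequently.mp hx) _ ((hd.continuousAt (hO.mem_nhds hxO)).preimage_mem_nhds (hA.mem_nhds hxA))
    have h2 : ∀ᶠ V in 𝓝[W] V₀, V ∈ B := mem_nhdsWithin_of_mem_nhds (hB.mem_nhds hVB)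
    obtain ⟨V, hVA, hVB', hVW⟩ := (h1.and_eventually (h2.and hl)).exists
    have : d (Us V) ∈ A ∩ B := ⟨hVA, by rw [hUsd V hVW]; exact hVB'⟩
    rw [Set.disjoint_iff_inter_eq_empty.mp hAB] at this
    exact this
  -- (c) g x ≥ g U for every competitor U in the fibre piece over V₀
  have hge : ∀ U, d U = V₀ → U ∈ O → g U ≤ g x := by
    intro U hU hUO
    by_contra hlt
    push Not at hlt
    obtain ⟨Φ, hΦc, hΦU, hΦd⟩ := hlift U hUO
    rw [hU] at hΦc hΦU hΦd
    set ε : ℝ := (g U - g x) / 2 with hε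
    have hεpos : 0 < ε := by rw [hε]; linarith
    -- near x, g < g x + ε
    have hgx : ContinuousAt g x := hg.continuousAt (hO.mem_nhds hxO)
    have hN : ∀ᶠ z in 𝓝 x, g z < g x + ε := hgx.eventually (gt_mem_nhds (by linarith))
    -- near V₀ (within W): g (Φ V) > g U − ε, Φ V ∈ O, d (Φ V) = V
    have hgΦ : ContinuousAt (fun V => g (Φ V)) V₀ :=
      (hg.continuousAt (hO.mem_nhds (by rw [hΦU]; exact hUO))).comp' (by simpa using hΦc)
    have hE1 : ∀ᶠ V in 𝓝 V₀, g U - ε < g (Φ V) := by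
      have := hgΦ.eventually (lt_mem_nhds (show g U - ε < g (Φ V₀) by rw [hΦU]; linarith))
      exact this
    have hE2 : ∀ᶠ V in 𝓝 V₀, Φ V ∈ O := hΦc.preimage_mem_nhds (hO.mem_nhds (by rw [hΦU]; exact hUO))
    have hE : ∀ᶠ V in 𝓝[W] V₀, g U - ε < g (Φ V) ∧ Φ V ∈ O ∧ d (Φ V) = V ∧ V ∈ W :=
      (((hE1.and (hE2.and hΦd)).filter_mono nhdsWithin_le_nhds).and hl).mono fun V h => ⟨h.1.1, h.1.2.1, h.1.2.2, h.2⟩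
    have hF : ∃ᶠ V in 𝓝[W] V₀, g (Us V) < g x + ε := (mapClusterPt_iff_frequently.mp hx) _ hN
    obtain ⟨V, hV1, hV2, hV3, hV4, hVW⟩ := (hF.and_eventually hE).exists
    have h3 : g (Φ V) ≤ g (Us V) := hmax V hVW (Φ V) hV4 hV3
    rw [hε] at hV1 hV2
    linarith
  -- (d) uniqueness at V₀
  exact huniq V₀ hV₀ x hdx hxO (hge (Us V₀) (hUsd V₀ hV₀) (hKO (hUsK V₀ hV₀)))

end Summit.QuantumFields.YangMills.Theorems.OrganTangentModeSectionTools
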